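import Literature.MathematicalPhysics.QuantumLattice.HubbardFermiSeaTangentRowsDiluteFarPlanes
import Literature.MathematicalPhysics.QuantumLattice.HubbardFermiSeaTangentRowsQuarterFilling
import Summits.Ventures.CertifiedManyBodySolver.Certificates.HubbardSquare_n1_tpm5o16_tpm3o16_U15o2_thermal_C1nodesTT_stair221_j318145_j318146
import Summits.Ventures.CertifiedManyBodySolver.Observables.PhaseSeparationExclusionBox
import Summits.Ventures.CertifiedManyBodySolver.Observables.PhaseSeparationExclusionBoxThermalFreeDilute
import Summits.Ventures.CertifiedManyBodySolver.Observables.PhaseSeparationExclusionBoxThermalHotInterp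
import Summits.Ventures.CertifiedManyBodySolver.Observables.PhaseSeparationExclusionMidSegmentCapThermal
import Summits.Ventures.CertifiedManyBodySolver.Observables.PhaseSeparationExclusionNearStripElectronSideColumns
import Summits.Ventures.CertifiedManyBodySolver.Observables.PhaseSeparationExclusionNearStripElectronSideColumnsB
import Summits.Ventures.CertifiedManyBodySolver.Observables.PhaseSeparationExclusionNearStripThermalQE
import Summits.Ventures.CertifiedManyBodySolver.Observables.PhaseSeparationExclusionWitnessSplitCap597
import HarnessLib
import HarnessLib.Audit

/-!
# Ventures/CertifiedManyBodySolver — Observables/PhaseSeparationExclusionNearStripESHotIThermalQE.lean: `(≤ 9/20 | ≥ 1)` on the La-214 strip segment `t′ ∈ [−1/4, −1/5]` (La214E ×10, CB1, LSCO-x0.30 M50), `U ≥ 15/2` — the `T > 0` word, HOT-ANCHORED edition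
# («THE ELECTRON-SIDE ROWS ON THE HOLE STRIP» × hubbard-thermal-eng-4's LSCO-corner Markov anchors, hubbard-downfold-unc-2 g33)

HONEST FRAMING: first certified bounds; not a superconductivity verdict. CLASS = DERIVED / CONTEXT (competing-order words, CONTROL class: the excluded partner phase has hole
doping `≥ 11/20`). The cells `U ∈ [15/2, 8] ∣ [8, 17/2] ∣ [8, 10] ∣ [10, 12] ∣ [12, 16]` of the ELECTRON-SIDE-ROW edition (`Observables/PhaseSeparationExclusionNearStripES{ThermalMott,AxesMott}*`,
this seat g33: caps, `n = 1` COLUMNS = hubbard-box-eng-2's B54/B67c/B85c hole-strip floors `es_n1_col{6,8,10}_d30` and their `U`-chords BY NAME, producer rows BY VALUE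
`hB54`/`hB67c`/`hB85c`; dilute floors = kernel Fermi-sea tangent rows; dilute `T > 0` anchor = kernel free gas `β* = 4`) RE-ANCHORED on the dense side with
hubbard-thermal-eng-4's `n = 1`-TUNED LSCO-CORNER staircase-Markov GC-pressure ceilings `lscoCorners_hotCap_n1_b{3o2,2,3}_on_cell_j318145_j318146`
(`Certificates/HubbardSquare_n1_tpm5o16_tpm3o16_U15o2_thermal_C1nodesTT_stair221_j318145_j318146.lean`, hubbard-thermal-eng-4 g2 p704865: `p(β_h; 1, s, U; 1) ≤ π(β_h)` for
`s ∈ [−5/16, −3/16]`, `U ≥ 15/2`, `π(3/2) = 1.3610895`, `π(2) = 1.6524596`, `π(3) = 2.3408403`; claim nodes `cert_feC1tt_stair221_tpm{5o16,3o16}_U15o2_n1_b*_j31814{5,6}` BY NAME —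
the same nodes this seat's g28 `…MidSegmentCapThermalLa214Tuned.lean` consumes): the dense term of the threshold numerator becomes `b·(π + β_h·L(s))` (`≈ 0.47–0.87`) instead of
`b·2 log 2` (a-priori) or `b·(C₀ + C₁(L − G))` (Mott, `≈ 1.1–1.3`); laws `psT_not_thermal_mix_on_cell_of_columns_hotAnchorSS_tcap` / `psHT_…_hotAnchorSS_tcap` /
`psGCT_…_hotAnchorSS_tcap` (this seat g22–g26); per cell the best `β_h ∈ {3/2, 2, 3}` and cap; `β₀ = max(β*, β_h, ⌈N/M⌉)` from the exact column data printed per theorem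
(generator asserts `N < β₀·M` in exact rationals; kernel re-check by `nlinarith`). Cells: K2 `[59 / 10,6]` β ≥ 46 (β_h = 3/2, WS597) ∣ K2 `[6,15 / 2]` β ≥ 30 (β_h = 3/2, WS597).
TARGET BOXES: cuprate box CB1 `[−0.3, −0.2] × [7.5, 8.5]` (whole box) and the `U ≥ 7.5` part of La₂₋ₓSrₓCuO₄ La214E ×10.
WHAT THIS IS NOT: a certificate or number of record; CONTROL-class words conditional BY NAME (WS597 / registry / K2DIAG / the two Markov claim nodes per `β_h`) and BY VALUE
(B54/B67c/B85c 10-dp floors, XL sheets) as printed in each signature; canonical sector-Gibbs torus limits / field / grand-canonical equilibria as variational notions (existence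
not claimed); nothing about stripes as states, ferromagnetism, superconductivity or `T_c`.

Seat hubbard-downfold-unc-2 g33 (`prover-hubbard-downfold-unc-2-g33-0`); generator `pub/hubbard-downfold/hubbard-downfold-unc-2/gen-g33/yb/gen33.py` (mode `hot`; exact `fractions`).
[cite: Israel1979, Thm. I.2.4] [cite: EmeryKivelsonLin1990, pp. 475–476] [cite: PoulinHastings2011, eqs. (3)–(8)] [cite: Griffiths1966, §II] [cite: Ruelle1969, §3.4] [cite: Israel1979, Thm. I.2.4] [cite: LiebPRL1989, proof of Theorem 1] [cite: PoulinHastings2011, eqs. (3)–(8)] [cite: Griffiths1964, §II] [cite: Israel1979, Thm. I.2.4] [cite: Griffiths1966, §II] [cite: PoulinHastings2011, eqs. (3)–(8)] [cite: Ruelle1969, §3.4] [cite: PoulinHastings2011, eqs. (3)–(8)] [cite: LiebLoss1993, §8, Theorem 8.2]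
-/

noncomputable section

namespace Summit.Ventures.CertifiedManyBodySolver.Observables

open Summit.Ventures.CertifiedManyBodySolver.Certificates Summit.Ventures.CertifiedManyBodySolver.Downfold
open Literature.MathematicalPhysics.QuantumLattice Literature.MathematicalPhysics.QuantumLattice.ThermodynamicLimit
open Literature.MathematicalPhysics.QuantumLattice.InfVolFermionState Set Filter

/-- **`(≤ 9/20 | ≥ 1)` at `T > 0`, HOT-ANCHORED — segment Q `t′ ∈ [-1 / 4, -1 / 5]`, columns `U ∈ [59 / 10, 6]`, EVERY `β ≥ 46`** (`T ≲ 76–126 K` for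
`t ∈ [0.30, 0.50] eV`). Witness filling `3 / 4` (`a, b = 5 / 11, 6 / 11`); cap = the registry WITNESS-SPLIT plane of the CERTIFIED #597 state at filling `3/4` (rows #634–#636, claim node `cert_plaqseam_W4split597_TBD_allmk` BY NAME; `wsplit597_cap_tcap_on_cell`, hubbard-box-p3 g34: `e(1,s,U,3/4) ≤ −1.12227 − 0.30531·s + 0.02875·U`); `n = 1` column laws `es_n1_law59o10x_d30` ∣ `es_n1_col6_d30` (ELECTRON-SIDE-ROW columns where
named `es_…`); dilute floor / kernel free-gas dilute anchor `β* = 4` (`free4_9o20_tpm1o4_tpm1o5`) as in the a-priori edition; DENSE ANCHOR = the `U`-CONVEXITY TRANSPORT `stripHotCap_b3o2_interpU_on_cell_Q` (`Observables/PhaseSeparationExclusionBoxThermalHotInterp.lean`, this seat g33): `p(3/2; 1, s, U; 1) ≤ V = 1.6835141` on the cell, `V` = the corner maximum of the chord between the FREE canonical pressure at `U = 0` (kernel, `Certificates/HubbardTTPrime_freeGC_kernelQuadrature_b3o2_strip_halfFilling.lean`: `A = 2.888∣2.872∣2.860` at `t′ = −3/10∣−1/4∣−1/5`) and hubbard-thermal-eng-4's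 LSCO-corner ceiling `π(3/2) = 1.3610895` at `U = 15/2` (claim nodes `cert_feC1tt_stair221_tpm{5o16,3o16}_U15o2_n1_b3o2_j31814{5,6}` BY NAME); law term `V + (3/2)·L(s)`. Exact column data (`T = 0` margin M, anchored
ratio N/M; `β₀ = max(β*, β_h, ⌈N/M⌉)`): `U = 59 / 10`: M 0.0121∣0.0087, N/M 33.72∣45.17; `U = 6`: M 0.0167∣0.0133, N/M 25.04∣30.30. [cite: Israel1979, Thm. I.2.4] [cite: EmeryKivelsonLin1990, pp. 475–476] [cite: PoulinHastings2011, eqs. (3)–(8)] [cite: Griffiths1966, §II] [cite: Ruelle1969, §3.4] [cite: PoulinHastings2011, eqs. (3)–(8)] -/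
theorem ehT_9o20_Q_59o10to6_beta46 (h597 : cert_plaqseam_W4split597_TBD_allmk) (hsX7o2m30 : ∀ m : ℝ, 0 ≤ m → m < 2 → (((-4601366382079312097374479/3022314549036572936765440 : ℚ)) : ℝ) + (((131232618655/274877906944 : ℚ)) : ℝ) * m ≤ energyDensityTT' 1 (-3/10) (7/2) m) (hB54 : ((-3505271351/5000000000 : ℚ) : ℝ) ≤ energyDensityTT' 1 (3 / 10) 6 1) (hLb3o2 : cert_feC1tt_stair221_tpm5o16_U15o2_n1_b3o2_j318145) (hRb3o2 : cert_feC1tt_stair221_tpm3o16_U15o2_n1_b3o2_j318146)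
    {s : ℝ} (hs : s ∈ Icc (-1 / 4 : ℝ) (-1 / 5)) {U : ℝ} (hU : U ∈ Icc (59 / 10 : ℝ) (6))
    {β : ℝ} (hβ : (46 : ℝ) ≤ β)
    {ω₁ ω₂ : InfVolFermionState 2} (h₁ : ω₁.IsTranslationInvariant) (h₂ : ω₂.IsTranslationInvariant)
    (hρ₁ : 0 < ω₁.density) (hρ₁' : ω₁.density ≤ 9 / 20) (hρ₂ : 1 ≤ ω₂.density) (hρ₂' : ω₂.density < 2)
    {n : ℝ} (hn0 : 0 < n) (hn2 : n < 2) {lam : ℝ} (hl0 : 0 < lam) (hl1 : lam < 1) {Ls : ℕ → ℕ}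
    (hLs : Tendsto Ls atTop atTop) :
    ¬ (mix lam hl0.le hl1.le ω₁ ω₂).IsTorusLimitOfMixture (sectorGibbsCount n) (fun L => sectorGibbsWeightTT' β 1 s U n L)
      (fun L => sectorGibbsVectorTT' 1 s U n L) Ls := by
  refine psT_not_thermal_mix_on_cell_of_columns_hotAnchorSS_tcap 1 (s₁ := -1 / 4) (s₂ := -1 / 5) (U₁ := 59 / 10) (U₂ := 6)
    (n₁ := 9 / 20) (n₂ := 1) (a := 5 / 11) (b := 6 / 11) (β₀ := 46) (βh₁ := 4) (βh₂ := 3 / 2)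
    (c₀ := ((-2467887174335/2199023255552 : ℚ) : ℝ)) (cs := ((-1342778035095/4398046511104 : ℚ) : ℝ)) (c₁ := ((252892912483/8796093022208 : ℚ) : ℝ))
    (by norm_num) (by norm_num) (by norm_num) (by norm_num) (by norm_num) (by norm_num) (by norm_num) (by norm_num)
    (by norm_num) (by norm_num) (by norm_num) (by norm_num) hβ (by norm_num)
    (wsplit597_cap_tcap_on_cell h597 (by norm_num) (by norm_num) (by norm_num))
    (fun s hs => es_n1_law59o10x_d30 hsX7o2m30 hB54 s ⟨hs.1.trans' (by norm_num), hs.2.trans (by norm_num)⟩)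
    (fun s hs => es_n1_col6_d30 hB54 s ⟨hs.1.trans' (by norm_num), hs.2.trans (by norm_num)⟩)
    (fun s hs U hU => floor_on_cell_of_tPrime_end_rows 1 (n := 9 / 20) (by norm_num) (by norm_num) (by norm_num)
      (fun _ hU' => fermiSeaTangentRow_tPrime_neg_one_div_four_at_nine_div_twenty hU' (by norm_num) (by norm_num)) (fun _ hU' => fermiSeaTangentRow_tPrime_neg_one_div_five_at_one_div_two hU' (by norm_num) (by norm_num)) s ⟨hs.1.trans' (by norm_num), hs.2.trans (by norm_num)⟩ U (by linarith [hU.1]))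
    (free4_9o20_tpm1o4_tpm1o5 (by norm_num) (by norm_num) (by norm_num))
    (stripHotCap_b3o2_interpU_on_cell_Q hLb3o2 hRb3o2 (U₁ := 59 / 10) (U₂ := 6) (V := ((16835141/10000000 : ℚ) : ℝ)) (by norm_num) (by norm_num) (by norm_num)
      (by intro A hA u hu; simp only [Set.mem_insert_iff, Set.mem_singleton_iff] at hA hu; rcases hA with rfl | rfl <;> rcases hu with rfl | rfl <;> norm_num))
    ?_ ?_ ?_ ?_ hs hU h₁ h₂ hρ₁ hρ₁' hρ₂ hρ₂' hn0 hn2 hl0 hl1 hLs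
  · intro s hs; obtain ⟨h1, h2⟩ := hs; push_cast; norm_num; nlinarith [h1, h2]
  · intro s hs; obtain ⟨h1, h2⟩ := hs; push_cast; norm_num; nlinarith [h1, h2]
  · intro s hs; obtain ⟨h1, h2⟩ := hs; push_cast; norm_num; nlinarith [h1, h2]
  · intro s hs; obtain ⟨h1, h2⟩ := hs; push_cast; norm_num; nlinarith [h1, h2]

/-- **`(≤ 9/20 | ≥ 1)` at `T > 0`, HOT-ANCHORED — segment Q `t′ ∈ [-1 / 4, -1 / 5]`, columns `U ∈ [6, 15 / 2]`, EVERY `β ≥ 30`** (`T ≲ 116–193 K` for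
`t ∈ [0.30, 0.50] eV`). Witness filling `3 / 4` (`a, b = 5 / 11, 6 / 11`); cap = the registry WITNESS-SPLIT plane of the CERTIFIED #597 state at filling `3/4` (rows #634–#636, claim node `cert_plaqseam_W4split597_TBD_allmk` BY NAME; `wsplit597_cap_tcap_on_cell`, hubbard-box-p3 g34: `e(1,s,U,3/4) ≤ −1.12227 − 0.30531·s + 0.02875·U`); `n = 1` column laws `es_n1_col6_d30` ∣ `es_n1_law15o2_d30` (ELECTRON-SIDE-ROW columns where
named `es_…`); dilute floor / kernel free-gas dilute anchor `β* = 4` (`free4_9o20_tpm1o4_tpm1o5`) as in the a-priori edition; DENSE ANCHOR = the `U`-CONVEXITY TRANSPORT `stripHotCap_b3o2_interpU_on_cell_Q` (`Observables/PhaseSeparationExclusionBoxThermalHotInterp.lean`, this seat g33): `p(3/2; 1, s, U; 1) ≤ V = 1.6633626` on the cell, `V` = the corner maximum of the chord between the FREE canonical pressure at `U = 0` (kernel, `Certificates/HubbardTTPrime_freeGC_kernelQuadrature_b3o2_strip_halfFilling.lean`: `A = 2.888∣2.872∣2.860` at `t′ = −3/10∣−1/4∣−1/5`) and hubbard-thermal-eng-4's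 LSCO-corner ceiling `π(3/2) = 1.3610895` at `U = 15/2` (claim nodes `cert_feC1tt_stair221_tpm{5o16,3o16}_U15o2_n1_b3o2_j31814{5,6}` BY NAME); law term `V + (3/2)·L(s)`. Exact column data (`T = 0` margin M, anchored
ratio N/M; `β₀ = max(β*, β_h, ⌈N/M⌉)`): `U = 6`: M 0.0167∣0.0133, N/M 24.38∣29.48; `U = 15 / 2`: M 0.0326∣0.0292, N/M 15.19∣16.45. [cite: Israel1979, Thm. I.2.4] [cite: EmeryKivelsonLin1990, pp. 475–476] [cite: PoulinHastings2011, eqs. (3)–(8)] [cite: Griffiths1966, §II] [cite: Ruelle1969, §3.4] [cite: PoulinHastings2011, eqs. (3)–(8)] -/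
theorem ehT_9o20_Q_6to15o2_beta30 (h597 : cert_plaqseam_W4split597_TBD_allmk) (hB54 : ((-3505271351/5000000000 : ℚ) : ℝ) ≤ energyDensityTT' 1 (3 / 10) 6 1) (hB67c : ((-5566907601/10000000000 : ℚ) : ℝ) ≤ energyDensityTT' 1 (3 / 10) 8 1) (hLb3o2 : cert_feC1tt_stair221_tpm5o16_U15o2_n1_b3o2_j318145) (hRb3o2 : cert_feC1tt_stair221_tpm3o16_U15o2_n1_b3o2_j318146)
    {s : ℝ} (hs : s ∈ Icc (-1 / 4 : ℝ) (-1 / 5)) {U : ℝ} (hU : U ∈ Icc (6 : ℝ) (15 / 2))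
    {β : ℝ} (hβ : (30 : ℝ) ≤ β)
    {ω₁ ω₂ : InfVolFermionState 2} (h₁ : ω₁.IsTranslationInvariant) (h₂ : ω₂.IsTranslationInvariant)
    (hρ₁ : 0 < ω₁.density) (hρ₁' : ω₁.density ≤ 9 / 20) (hρ₂ : 1 ≤ ω₂.density) (hρ₂' : ω₂.density < 2)
    {n : ℝ} (hn0 : 0 < n) (hn2 : n < 2) {lam : ℝ} (hl0 : 0 < lam) (hl1 : lam < 1) {Ls : ℕ → ℕ}
    (hLs : Tendsto Ls atTop atTop) :
    ¬ (mix lam hl0.le hl1.le ω₁ ω₂).IsTorusLimitOfMixture (sectorGibbsCount n) (fun L => sectorGibbsWeightTT' β 1 s U n L)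
      (fun L => sectorGibbsVectorTT' 1 s U n L) Ls := by
  refine psT_not_thermal_mix_on_cell_of_columns_hotAnchorSS_tcap 1 (s₁ := -1 / 4) (s₂ := -1 / 5) (U₁ := 6) (U₂ := 15 / 2)
    (n₁ := 9 / 20) (n₂ := 1) (a := 5 / 11) (b := 6 / 11) (β₀ := 30) (βh₁ := 4) (βh₂ := 3 / 2)
    (c₀ := ((-2467887174335/2199023255552 : ℚ) : ℝ)) (cs := ((-1342778035095/4398046511104 : ℚ) : ℝ)) (c₁ := ((252892912483/8796093022208 : ℚ) : ℝ))
    (by norm_num) (by norm_num) (by norm_num) (by norm_num) (by norm_num) (by norm_num) (by norm_num) (by norm_num)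
    (by norm_num) (by norm_num) (by norm_num) (by norm_num) hβ (by norm_num)
    (wsplit597_cap_tcap_on_cell h597 (by norm_num) (by norm_num) (by norm_num))
    (fun s hs => es_n1_col6_d30 hB54 s ⟨hs.1.trans' (by norm_num), hs.2.trans (by norm_num)⟩)
    (fun s hs => es_n1_law15o2_d30 hB54 hB67c s ⟨hs.1.trans' (by norm_num), hs.2.trans (by norm_num)⟩)
    (fun s hs U hU => floor_on_cell_of_tPrime_end_rows 1 (n := 9 / 20) (by norm_num) (by norm_num) (by norm_num)
      (fun _ hU' => fermiSeaTangentRow_tPrime_neg_one_div_four_at_nine_div_twenty hU' (by norm_num) (by norm_num)) (fun _ hU' => fermiSeaTangentRow_tPrime_neg_one_div_five_at_one_div_two hU' (by norm_num) (by norm_num)) s ⟨hs.1.trans' (by norm_num), hs.2.trans (by norm_num)⟩ U (by linarith [hU.1]))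
    (free4_9o20_tpm1o4_tpm1o5 (by norm_num) (by norm_num) (by norm_num))
    (stripHotCap_b3o2_interpU_on_cell_Q hLb3o2 hRb3o2 (U₁ := 6) (U₂ := 15 / 2) (V := ((8316813/5000000 : ℚ) : ℝ)) (by norm_num) (by norm_num) (by norm_num)
      (by intro A hA u hu; simp only [Set.mem_insert_iff, Set.mem_singleton_iff] at hA hu; rcases hA with rfl | rfl <;> rcases hu with rfl | rfl <;> norm_num))
    ?_ ?_ ?_ ?_ hs hU h₁ h₂ hρ₁ hρ₁' hρ₂ hρ₂' hn0 hn2 hl0 hl1 hLs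
  · intro s hs; obtain ⟨h1, h2⟩ := hs; push_cast; norm_num; nlinarith [h1, h2]
  · intro s hs; obtain ⟨h1, h2⟩ := hs; push_cast; norm_num; nlinarith [h1, h2]
  · intro s hs; obtain ⟨h1, h2⟩ := hs; push_cast; norm_num; nlinarith [h1, h2]
  · intro s hs; obtain ⟨h1, h2⟩ := hs; push_cast; norm_num; nlinarith [h1, h2]

end Summit.Ventures.CertifiedManyBodySolver.Observables

end
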